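import Summits.Ventures.GridStability.Models.StructurePreservingInstance

/-!
# GridStability/Models/StructurePreservingGenLast — «machines LAST» generator set + bridges + linear bulk driver (G2-SCALE Q4 arch-3 library module)

Venture GRIDFUSION, G2-SCALE cell, Q4 «OPERATOR-SIZE» (DIRECTOR RULING 80 (2); lead §41 D54 (ii): writer gridfusion-sos-5 (g10) on
gridfusion-sos-2 (g14)'s signatures, E1 SUPPLEMENT STATUS 2026-08-28T19:03Z). GENERIC, no instance data, 0 kit.
WHY (sos-2 / crit-1 E1 component model, STATUS l.10476 / l.10486 / lead l.10490): in the structure-preserving instance modules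
(`Models/<X>SP(b).lean`) the two `WellFormed` bulk facts `∀ i ∈ genS, 0 < Mᵢ` and `∀ i ∉ genS, Mᵢ = 0` were decided against a
LITERAL `Finset` `genS`, costing `N·G` membership steps in the kernel (≈ 15–17 s per fact at `N·G = 158 k`, ≈ 220 s predicted at the
Q4 object 2 710 × 327, hard wall near `N·G ≈ 2.4·10⁶`). The emitter's convention is that the `G` machine (internal) nodes are the
LAST `G` indices. This module provides:
* `genLast n G` — the `Finset` of the last `G` indices of `Fin n`, `mem_genLast : i ∈ genLast n G ↔ n − G ≤ i.val`, and the
  BRIDGE `mem_genLast_of_le : n − G ≤ i.val → i ∈ genLast n G` (sos-2's «internal nodes LAST» lemma);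
* `forall_not_mem_genLast_of_or` — `M_eq_zero` from the membership-free bulk fact `∀ i : Fin n, P i ∨ n − G ≤ i.val`;
* `forall_mem_genLast_iff` / `forall_not_mem_genLast_iff` (+ `_of` forms) — a fact over the members (non-members) IS the fact over
  `Fin G` at `⟨n − G + k⟩` (over `Fin (n − G)` at `⟨k⟩`): decided over `G` (resp. `n − G`) indices, no membership test at all;
* the LINEAR BULK DRIVER `forall_fin_of_finRange_all` (`(List.finRange n).all p = true → ∀ i, p i`, one structural pass) with the
  combined one-pass forms `forall_mem_genLast_of_finRange_all` / `forall_not_mem_genLast_of_finRange_all`;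
* `card_genLast`.
Instance STATEMENTS are unchanged by using these (the same `WellFormed` fields are re-proved); `def genS := genLast N G` replaces the
literal set (same set: `genLast_eq_iff` lets a literal be checked against it by `decide` if wanted). [folklore]
-/

namespace Summit.Ventures.GridStability.Models.StructurePreserving

/-! ## The «machines LAST» generator set -/

/-- **Machines LAST**: the last `G` indices of `Fin n`, i.e. `{i | n − G ≤ i}` (for `G ≤ n` exactly `G` elements). [folklore] -/
def genLast (n G : ℕ) : Finset (Fin n) := Finset.univ.filter fun i => n - G ≤ i.val

/-- Membership in `genLast` is the comparison `n − G ≤ i`. [folklore] -/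
@[simp] theorem mem_genLast {n G : ℕ} {i : Fin n} : i ∈ genLast n G ↔ n - G ≤ i.val := by
  simp [genLast]

/-- **The bridge** («internal nodes LAST»): `n − G ≤ i ⇒ i ∈ genLast n G`. [folklore] -/
theorem mem_genLast_of_le {n G : ℕ} {i : Fin n} (h : n - G ≤ i.val) : i ∈ genLast n G := mem_genLast.2 h

/-- `i < n − G ⇒ i ∉ genLast n G`. [folklore] -/
theorem not_mem_genLast_of_lt {n G : ℕ} {i : Fin n} (h : i.val < n - G) : i ∉ genLast n G :=
  fun hi => absurd (mem_genLast.1 hi) (not_le.2 h)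

/-- `i ∉ genLast n G ⇒ i < n − G`. [folklore] -/
theorem lt_of_not_mem_genLast {n G : ℕ} {i : Fin n} (h : i ∉ genLast n G) : i.val < n - G :=
  not_le.1 fun hle => h (mem_genLast_of_le hle)

/-- A literal generator set equals `genLast n G` iff its membership is the comparison (lets an emitter keep a literal and check it
once by `decide`, or simply define `genS := genLast n G`). [folklore] -/
theorem genLast_eq_iff {n G : ℕ} {s : Finset (Fin n)} : s = genLast n G ↔ ∀ i, i ∈ s ↔ n - G ≤ i.val := by
  constructor
  · rintro rfl i; exact mem_genLast
  · intro h; ext i; rw [h i, mem_genLast]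

/-- `genLast n G` has `G` elements when `G ≤ n`. [folklore] -/
theorem card_genLast {n G : ℕ} (hG : G ≤ n) : (genLast n G).card = G := by
  have h : genLast n G = Finset.univ.image (fun k : Fin G => (⟨n - G + k.val, by omega⟩ : Fin n)) := by
    ext i
    simp only [mem_genLast, Finset.mem_image, Finset.mem_univ, true_and]
    constructor
    · intro hi
      exact ⟨⟨i.val - (n - G), by omega⟩, Fin.ext (by simp; omega)⟩
    · rintro ⟨k, rfl⟩
      simp
  rw [h, Finset.card_image_of_injective _ (fun a b hab => by
    have h1 : n - G + a.val = n - G + b.val := by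
      have := congrArg Fin.val hab
      simpa using this
    exact Fin.ext (by omega))]
  simp

/-! ## Bridges for the two `WellFormed` bulk facts -/

/-- **`M_eq_zero` from a membership-free bulk fact**: `∀ i, P i ∨ n − G ≤ i` gives `P` at every non-member. [folklore] -/
theorem forall_not_mem_genLast_of_or {n G : ℕ} {P : Fin n → Prop} (h : ∀ i : Fin n, P i ∨ n - G ≤ i.val) :
    ∀ i, i ∉ genLast n G → P i :=
  fun i hi => (h i).resolve_right (not_le.2 (lt_of_not_mem_genLast hi))

/-- **`M_pos` from a membership-free bulk fact**: `∀ i, P i ∨ i < n − G` gives `P` at every member. [folklore] -/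
theorem forall_mem_genLast_of_or {n G : ℕ} {P : Fin n → Prop} (h : ∀ i : Fin n, P i ∨ i.val < n - G) :
    ∀ i ∈ genLast n G, P i :=
  fun i hi => (h i).resolve_right (not_lt.2 (mem_genLast.1 hi))

/-- **Members as `Fin G`**: a fact for every machine index is the fact for every `k : Fin G` at `i = ⟨n − G + k⟩` (decided over
`G` indices, no membership test). [folklore] -/
theorem forall_mem_genLast_iff {n G : ℕ} (hG : G ≤ n) {P : Fin n → Prop} :
    (∀ i ∈ genLast n G, P i) ↔ ∀ k : Fin G, P ⟨n - G + k.val, by omega⟩ := by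
  constructor
  · intro h k
    exact h _ (mem_genLast_of_le (by simp))
  · intro h i hi
    have hi' := mem_genLast.1 hi
    have := h ⟨i.val - (n - G), by omega⟩
    convert this using 2
    show i.val = n - G + (i.val - (n - G))
    omega

/-- **Non-members as `Fin (n − G)`**: a fact for every bus index is the fact for every `k : Fin (n − G)` at `i = ⟨k⟩`. [folklore] -/
theorem forall_not_mem_genLast_iff {n G : ℕ} {P : Fin n → Prop} :
    (∀ i, i ∉ genLast n G → P i) ↔ ∀ k : Fin (n - G), P ⟨k.val, by omega⟩ := by
  constructor
  · intro h k
    exact h _ (not_mem_genLast_of_lt (by simp))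
  · intro h i hi
    have := h ⟨i.val, lt_of_not_mem_genLast hi⟩
    convert this using 2

/-- Members, implication form. [folklore] -/
theorem forall_mem_genLast_of {n G : ℕ} (hG : G ≤ n) {P : Fin n → Prop} (h : ∀ k : Fin G, P ⟨n - G + k.val, by omega⟩) :
    ∀ i ∈ genLast n G, P i :=
  (forall_mem_genLast_iff hG).2 h

/-- Non-members, implication form. [folklore] -/
theorem forall_not_mem_genLast_of {n G : ℕ} {P : Fin n → Prop} (h : ∀ k : Fin (n - G), P ⟨k.val, by omega⟩) :
    ∀ i, i ∉ genLast n G → P i :=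
  forall_not_mem_genLast_iff.2 h

/-! ## The linear bulk driver -/

/-- **Linear bulk driver**: one structural pass of `List.all` over `List.finRange n` proves a Boolean fact at every index. [folklore] -/
theorem forall_fin_of_finRange_all {n : ℕ} {p : Fin n → Bool} (h : (List.finRange n).all p = true) :
    ∀ i : Fin n, p i = true :=
  fun i => List.all_eq_true.1 h i (List.mem_finRange i)

/-- The driver is exact: `∀ i, p i` iff the pass accepts. [folklore] -/
theorem forall_fin_iff_finRange_all {n : ℕ} {p : Fin n → Bool} :
    (∀ i : Fin n, p i = true) ↔ (List.finRange n).all p = true :=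
  ⟨fun h => List.all_eq_true.2 fun i _ => h i, forall_fin_of_finRange_all⟩

/-- Propositional form: a decidable predicate holds at every index once the pass over `decide ∘ P` accepts. [folklore] -/
theorem forall_fin_of_finRange_all_decide {n : ℕ} {P : Fin n → Prop} [DecidablePred P]
    (h : (List.finRange n).all (fun i => decide (P i)) = true) : ∀ i : Fin n, P i :=
  fun i => of_decide_eq_true (forall_fin_of_finRange_all h i)

/-- Combined: a fact over the machine indices by ONE pass over `List.finRange G`. [folklore] -/
theorem forall_mem_genLast_of_finRange_all {n G : ℕ} (hG : G ≤ n) {P : Fin n → Prop} [DecidablePred P]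
    (h : (List.finRange G).all (fun k => decide (P ⟨n - G + k.val, by omega⟩)) = true) :
    ∀ i ∈ genLast n G, P i :=
  forall_mem_genLast_of hG (forall_fin_of_finRange_all_decide h)

/-- Combined: a fact over the bus indices by ONE pass over `List.finRange (n − G)`. [folklore] -/
theorem forall_not_mem_genLast_of_finRange_all {n G : ℕ} {P : Fin n → Prop} [DecidablePred P]
    (h : (List.finRange (n - G)).all (fun k => decide (P ⟨k.val, by omega⟩)) = true) :
    ∀ i, i ∉ genLast n G → P i :=
  forall_not_mem_genLast_of (forall_fin_of_finRange_all_decide h)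

/-! ## Smoke checks (tiny; the three proof routes an instance can use) -/

example : genLast 5 2 = {3, 4} := by decide
example : ∀ i ∈ genLast 5 2, (0 : ℚ) < (if 3 ≤ i.val then 1 else 0) :=
  forall_mem_genLast_of_finRange_all (by norm_num) (by decide)
example : ∀ i, i ∉ genLast 5 2 → (if 3 ≤ i.val then (1 : ℚ) else 0) = 0 :=
  forall_not_mem_genLast_of_finRange_all (by decide)
example : ∀ i, i ∉ genLast 5 2 → (if 3 ≤ i.val then (1 : ℚ) else 0) = 0 :=
  forall_not_mem_genLast_of_or (by decide)
example : ∀ i ∈ genLast 5 2, (0 : ℚ) < (if 3 ≤ i.val then 1 else 0) := by decide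

end Summit.Ventures.GridStability.Models.StructurePreserving
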